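import Summits.QuantumAdvantage.QuantumAdvantage.Theorems.WbwThesis.Negative.LoadBearing
import Literature.Computability.Complexity.CountingHierarchyProofs

/-!
# `WbwThesis` (stmt-QuantumAdvantage-2238) — II: the guessing bound, bounded answers refuted, planted ⇒ one-way

Sequel of `LoadBearing.lean` (I); same provenance (refuter work file
`Summits/QuantumAdvantage/QuantumAdvantage/Cruxes/WbwThesis/Disproof.lean`, cycle 1). Sorry-free; no Theses
decl is asserted positively.

* §3 GUESSING BOUND: the coin-echo adversary `guess q` is PPT (`guess_isPPT`, the tree's second pair
  projection) and outputs a string with prefix `a` with probability exactly `2^{-|a|}` (`guess_pr`); hence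
  any pair satisfying (C) has `E_{s ∈ {0,1}ⁿ}[2^{-|ans s|}]` negligible (`answerLength_decay_of_clauseC`),
  `O(log n)`-bit answers on all seeds of infinitely many lengths kill (C) (`clauseC_false_of_log_answers`),
  and the "decision-type" variant of X with answers of BOUNDED length is FALSE
  (`not_wbwThesisBoundedAnswers`) — X is irreducibly a search statement.
* §4 PLANTED ⇒ ONE-WAY: with `ans ∈ FP` in addition (every planted generator, e.g. the glued-trees
  witness `ans s = name_k(EXIT)`), (Q)+(C) make `gen` a strong one-way function
  (`isOneWay_gen_of_planted`, `exists_isOneWay_of_wbwThesisPlanted`; Goldreich 2001, Def. 2.2.1): the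
  planted thesis is an OWF-strength hypothesis, and "the instance hides the seed" is a necessary condition
  on the generator of crux `WbwObfuscatedGluedTrees`, checkable without any iO security notion.
-/

set_option linter.dupNamespace false

namespace Summit.QuantumAdvantage.QuantumAdvantage.Theorems.WbwThesis.Negative

open Literature.Computability.Cryptography Literature.Computability.Complexity
open _root_.Computability Filter Asymptotics

/-! ## §3 GUESSING BOUND: answers must be long; bounded-length ("decision-type") variants are false -/

/-- Evaluation of an `ℕ`-polynomial is monotone (local copy of a tree folklore lemma). [folklore] -/
theorem eval_mono_nat (q : Polynomial ℕ) {a b : ℕ} (h : a ≤ b) : q.eval a ≤ q.eval b := by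
  induction q using Polynomial.induction_on' with
  | add p q hp hq => simp only [Polynomial.eval_add]; exact Nat.add_le_add hp hq
  | monomial n c =>
    simp only [Polynomial.eval_monomial]
    exact Nat.mul_le_mul_left c (Nat.pow_le_pow_left h n)

/-- The COIN-ECHO (guessing) adversary with coin budget `q`: output the coin string. [folklore] -/
def guess (q : Polynomial ℕ) : RandAlg (List Bool) (List Bool) where
  run _ r := r
  coinLen m := q.eval m

/-- The guessing adversary is PPT (`⟨x, r⟩ ↦ r` is the tree's second pair projection
`polyTimeComputable_snd_holds`; coin budget `q`). [folklore] -/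
theorem guess_isPPT (q : Polynomial ℕ) : IsPPT (guess q) id := by
  refine ⟨?_, q, fun n => le_rfl⟩
  exact PolyTimeComputable.of_encode_eq (f := (Prod.snd : List Bool × List Bool → List Bool))
    (fun w : List Bool × List Bool => w) (fun _ => rfl) (fun _ => rfl) polyTimeComputable_snd_holds

/-- Exactly one string of length `|a|` equals `a`: `Pr_{r ∈ {0,1}^{|a|}}[r = a] = 2^{-|a|}`. [folklore] -/
theorem uniformProb_singleton_self (a : List Bool) :
    uniformProb a.length ({a} : Set (List Bool)) = 2⁻¹ ^ a.length := by
  classical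
  have hcard : ∀ (inst : DecidablePred fun r : List.Vector Bool a.length => r.toList ∈ ({a} : Set (List Bool))),
      (@Finset.filter _ (fun r : List.Vector Bool a.length => r.toList ∈ ({a} : Set (List Bool))) inst
        Finset.univ).card = 1 := by
    intro inst
    rw [Finset.card_eq_one]
    refine ⟨⟨a, rfl⟩, Finset.ext fun r => ?_⟩
    simp only [Finset.mem_filter, Finset.mem_univ, true_and, Set.mem_singleton_iff,
      Finset.mem_singleton]
    exact ⟨fun h => List.Vector.eq _ _ h, fun h => h ▸ rfl⟩
  unfold uniformProb
  rw [hcard, Nat.cast_one, one_div, inv_pow]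

/-- **Success probability of guessing**: on any input `z`, the coin-echo adversary outputs a string
with prefix `a` with probability exactly `2^{-|a|}`, provided its coin budget covers `|a|`.
[folklore] -/
theorem guess_pr (q : Polynomial ℕ) (z a : List Bool) (ha : a.length ≤ q.eval z.length) :
    (guess q).pr id z {y | a <+: y} = 2⁻¹ ^ a.length := by
  rw [pr_eq_uniformProb']
  have hE : {r : List Bool | (guess q).run z r ∈ {y : List Bool | a <+: y}} =
      {r | r.take a.length ∈ ({a} : Set (List Bool))} := by
    ext r
    simp only [guess, Set.mem_setOf_eq, Set.mem_singleton_iff]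
    rw [List.prefix_iff_eq_take]
    exact eq_comm
  rw [hE]
  exact (uniformProb_take_of_le ha _).trans (uniformProb_singleton_self a)

/-- **Answer-length decay is necessary.** If `|ans s| ≤ p(|gen s|)` for all `s` (in X: equality) and
clause (C) holds for `(gen, ans)`, then `n ↦ E_{s ∈ {0,1}ⁿ}[2^{-|ans s|}]` decays superpolynomially:
it IS the success probability of the PPT guessing adversary with coin budget `p` (the instance
`⟨1ⁿ, gen s⟩` is longer than `gen s`, so the budget `p(|⟨1ⁿ, gen s⟩|) ≥ p(|gen s|) ≥ |ans s|`
suffices). [folklore] -/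
theorem answerLength_decay_of_clauseC {gen ans : List Bool → List Bool} {p : Polynomial ℕ}
    (hp : ∀ s, (ans s).length ≤ p.eval (gen s).length) (hC : ClauseC gen ans) :
    SuperpolynomialDecay atTop (fun n : ℕ => (n : ℝ))
      (fun n : ℕ => uniformAvg n fun s => (2⁻¹ : ℝ) ^ (ans s).length) := by
  have h := hC (guess p) (guess_isPPT p)
  refine (congrArg (SuperpolynomialDecay atTop (fun n : ℕ => (n : ℝ))) (funext fun n => ?_)).mp h
  refine congrArg (fun g => uniformAvg n g) (funext fun s => guess_pr p _ _ ((hp s).trans ?_))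
  exact eval_mono_nat p (by simp)

/-- **Short answers kill (C).** If on infinitely many lengths `n` EVERY seed of length `n` has an answer
of at most `k · log₂ n` bits, clause (C) fails (guessing succeeds with probability `≥ n^{-k}` there).
[folklore] -/
theorem clauseC_false_of_log_answers {gen ans : List Bool → List Bool} {p : Polynomial ℕ}
    (hp : ∀ s, (ans s).length ≤ p.eval (gen s).length) (k : ℕ)
    (h : ∃ᶠ n in atTop, ∀ s : List Bool, s.length = n → (ans s).length ≤ k * Nat.log 2 n) :
    ¬ ClauseC gen ans := by
  intro hC
  have hdec := (answerLength_decay_of_clauseC hp hC) k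
  -- along the frequent lengths, `n^k * avg ≥ 1`
  have hfreq : ∃ᶠ n : ℕ in atTop, (1 : ℝ) ≤ (n : ℝ) ^ k * uniformAvg n fun s => (2⁻¹ : ℝ) ^ (ans s).length := by
    refine (h.and_eventually (eventually_ge_atTop 1)).mono fun n ⟨hn, hn1⟩ => ?_
    have hpt : ∀ s : List Bool, s.length = n → (1 : ℝ) ≤ (n : ℝ) ^ k * (2⁻¹ : ℝ) ^ (ans s).length := by
      intro s hs
      have h2 : (2⁻¹ : ℝ) ^ (k * Nat.log 2 n) ≤ (2⁻¹ : ℝ) ^ (ans s).length :=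
        pow_le_pow_of_le_one (by norm_num) (by norm_num) (hn s hs)
      have h3 : (1 : ℝ) ≤ (n : ℝ) ^ k * (2⁻¹ : ℝ) ^ (k * Nat.log 2 n) := by
        rw [pow_mul', ← mul_pow, inv_pow, ← div_eq_mul_inv]
        refine one_le_pow₀ ?_
        rw [le_div_iff₀ (by positivity), one_mul]
        exact_mod_cast Nat.pow_log_le_self 2 (by omega)
      exact h3.trans (mul_le_mul_of_nonneg_left h2 (by positivity))
    calc (1 : ℝ) = uniformAvg n fun _ => 1 := by
            simp [uniformAvg, card_vector]
      _ ≤ uniformAvg n fun s => (n : ℝ) ^ k * (2⁻¹ : ℝ) ^ (ans s).length := by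
            unfold uniformAvg
            exact div_le_div_of_nonneg_right (Finset.sum_le_sum fun x _ => hpt x.toList (by simp))
              (by positivity)
      _ = (n : ℝ) ^ k * uniformAvg n fun s => (2⁻¹ : ℝ) ^ (ans s).length := by
            simp only [uniformAvg, ← Finset.mul_sum, mul_div_assoc]
  have hev : ∀ᶠ n : ℕ in atTop, (n : ℝ) ^ k * uniformAvg n (fun s => (2⁻¹ : ℝ) ^ (ans s).length) < 1 :=
    hdec.eventually (gt_mem_nhds one_pos)
  obtain ⟨n, hn, hlt⟩ := (hfreq.and_eventually hev).exists
  exact absurd hlt (not_lt.2 hn)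

/-- **The bounded-answer ("decision-type") variant of X is false** — `WbwThesis` with the polynomial
answer length replaced by a CONSTANT BOUND `|ans s| ≤ k`, whatever `gen` and the quantum family: guessing `k`
coins succeeds with probability `≥ 2^{-k}` on every seed, a constant. In particular a ONE-BIT answer
(a planted DECISION problem) can never satisfy (C) as typed — X is irreducibly a search statement,
and the route's passage to promise DECISION problems (`WbwSearchToPromise`) is where worst-case
quantifiers replace the average. [folklore] -/
theorem not_wbwThesisBoundedAnswers :
    ¬ ∃ (gen ans : List Bool → List Bool), PolyTimeComputable id id gen ∧
      (∃ k : ℕ, ∀ s, (ans s).length ≤ k) ∧ ClauseQ gen ans ∧ ClauseC gen ans := by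
  rintro ⟨gen, ans, -, ⟨k, hk⟩, -, hC⟩
  have hp : ∀ s, (ans s).length ≤ (Polynomial.C k : Polynomial ℕ).eval (gen s).length := fun s => by
    simpa using hk s
  have hdec := (answerLength_decay_of_clauseC hp hC) 0
  simp only [pow_zero, one_mul] at hdec
  have hev : ∀ᶠ n : ℕ in atTop, uniformAvg n (fun s => (2⁻¹ : ℝ) ^ (ans s).length) < (2⁻¹ : ℝ) ^ k :=
    hdec.eventually (gt_mem_nhds (by positivity))
  obtain ⟨n, hn⟩ := hev.exists
  refine absurd hn (not_lt.2 ?_)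
  calc (2⁻¹ : ℝ) ^ k = uniformAvg n fun _ => (2⁻¹ : ℝ) ^ k := by
          simp only [uniformAvg, Finset.sum_const, Finset.card_univ, card_vector, Fintype.card_bool,
            nsmul_eq_mul]
          push_cast
          rw [eq_div_iff (by positivity), mul_comm]
    _ ≤ uniformAvg n fun s => (2⁻¹ : ℝ) ^ (ans s).length := by
          unfold uniformAvg
          exact div_le_div_of_nonneg_right (Finset.sum_le_sum fun x _ =>
            pow_le_pow_of_le_one (by norm_num) (by norm_num) (hk _)) (by positivity)

/-! ## §4 PLANTED ⇒ ONE-WAY: with answers in FP, (Q)+(C) make the generator a one-way function -/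

/-- Post-composition of a randomized algorithm with a deterministic map (same coins). [folklore] -/
def postCompose (f : List Bool → List Bool) (A : RandAlg (List Bool) (List Bool)) :
    RandAlg (List Bool) (List Bool) where
  run z r := f (A.run z r)
  coinLen := A.coinLen

/-- PPT is preserved by FP post-processing (tree: `PolyTimeComputable.comp_holds`). [folklore] -/
theorem postCompose_isPPT {f : List Bool → List Bool} (hf : PolyTimeComputable id id f)
    {A : RandAlg (List Bool) (List Bool)} (hA : IsPPT A id) : IsPPT (postCompose f A) id :=
  ⟨PolyTimeComputable.comp_holds hf hA.1, hA.2⟩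

/-- Monotonicity of `RandAlg.pr` along an implication between output events of two algorithms with
the same coins: if every coin string that puts `A`'s output in `S` puts `B`'s output in `E`, then
`Pr[A ∈ S] ≤ Pr[B ∈ E]`. [folklore] -/
theorem pr_le_pr_of_imp {A B : RandAlg (List Bool) (List Bool)} (hcoin : A.coinLen = B.coinLen)
    (z : List Bool) {S E : Set (List Bool)} (h : ∀ r, A.run z r ∈ S → B.run z r ∈ E) :
    A.pr id z S ≤ B.pr id z E := by
  classical
  rw [pr_eq_uniformProb', pr_eq_uniformProb', hcoin]
  unfold uniformProb
  refine div_le_div_of_nonneg_right ?_ (by positivity)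
  exact_mod_cast Finset.card_le_card fun r hr => by
    simp only [Finset.mem_filter, Finset.mem_univ, true_and, Set.mem_setOf_eq] at hr ⊢
    exact h _ hr

/-- **Planted X makes the generator one-way.** If `gen, ans ∈ FP`, (Q) holds (so answers are a
function of instances, `ans_eq_of_gen_eq`) and (C) holds, then `gen` is a (strong) one-way function:
a PPT inverter `A` finding SOME preimage `s'` of `gen s` with probability `ε(n)` yields the PPT solver
`ans ∘ A` with success `≥ ε(n)` (`ans s' = ans s`), so `ε` is negligible. Consequences: the planted
thesis implies OWF (hence `NP ⊄ BPP`; no unconditional proof), and for the intended witness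
(crux `WbwObfuscatedGluedTrees`) "`(iO(N_k), name_k(ENTRANCE))` hides the seed" is a NECESSARY
condition, testable without any iO security notion. [cite: Goldreich2001, Def. 2.2.1] -/
theorem isOneWay_gen_of_planted {gen ans : List Bool → List Bool} (hgen : PolyTimeComputable id id gen)
    (hans : PolyTimeComputable id id ans) {p : Polynomial ℕ}
    (hp : ∀ s, (ans s).length = p.eval (gen s).length) {F : QCircuitFamily cliffordT}
    (hQ : ∀ s, 2 / 3 ≤ F.kernelProb 0 (gen s) {y | ans s <+: y}) (hC : ClauseC gen ans) :
    IsOneWay gen := by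
  refine ⟨hgen, fun A hA => ?_⟩
  have hB := hC (postCompose ans A) (postCompose_isPPT hans hA)
  refine hB.trans_abs_le fun n => ?_
  rw [abs_of_nonneg (invertProb_nonneg _ _ _),
    abs_of_nonneg (uniformAvg_nonneg fun _ => RandAlg.pr_nonneg _ _ _ _)]
  unfold invertProb uniformAvg
  refine div_le_div_of_nonneg_right (Finset.sum_le_sum fun x _ => ?_) (by positivity)
  dsimp only
  refine pr_le_pr_of_imp (A := A) (B := postCompose ans A) rfl _ fun r hr => ?_
  have e : ans (A.run (boolPair (unaryEncodeNat n) (gen x.toList)) r) = ans x.toList :=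
    ans_eq_of_gen_eq hp hQ hr
  show ans x.toList <+: ans (A.run (boolPair (unaryEncodeNat n) (gen x.toList)) r)
  exact ⟨[], by rw [List.append_nil, e]⟩

/-- **Planted X ⇒ one-way functions exist.** The PLANTED thesis is X with, in addition, `ans ∈ FP`
(answers efficiently computable from the seed, as for every planted generator, e.g.
`ans s = name_k(EXIT)`; it implies X by dropping the conjunct). So the planted thesis (the form every
intended witness has, is at least as strong as `∃ OWF` and admits no unconditional proof; dually an unconditional
refutation of X refutes every planted witness, e.g. every FP-samplable average-case-hard DLOG
generator, by §1). [cite: Goldreich2001, Def. 2.2.1] -/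
theorem exists_isOneWay_of_wbwThesisPlanted
    (h : ∃ (gen ans : List Bool → List Bool), PolyTimeComputable id id gen ∧ PolyTimeComputable id id ans ∧
      (∃ p : Polynomial ℕ, ∀ s, (ans s).length = p.eval (gen s).length) ∧
      ClauseQ gen ans ∧ ClauseC gen ans) :
    ∃ f, IsOneWay f := by
  obtain ⟨gen, ans, hgen, hans, ⟨p, hp⟩, ⟨F, -, -, hQ⟩, hC⟩ := h
  exact ⟨gen, isOneWay_gen_of_planted hgen hans hp hQ hC⟩

end Summit.QuantumAdvantage.QuantumAdvantage.Theorems.WbwThesis.Negative
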